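import Summits.ValiantsHypothesis.ValiantsHypothesis.Theorems.DivisionGapPerDivisionHardStubJssContraction
import Summits.ValiantsHypothesis.ValiantsHypothesis.Theorems.DivisionGapPerDivisionHardStubFaceDescent
import Summits.ValiantsHypothesis.ValiantsHypothesis.Theorems.DivisionGapPerDivisionHardStubBlockArsenal
import Summits.ValiantsHypothesis.ValiantsHypothesis.Theorems.DivisionGapPerDivisionHardStubGenericCut
import Summits.ValiantsHypothesis.ValiantsHypothesis.Theorems.DivisionGapPerDivisionHardStubTorusSupport
import Summits.ValiantsHypothesis.ValiantsHypothesis.Theorems.DivisionGapPerDivisionHardStubSparseRigid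

/-!
# Crux `DivisionGap.PerDivisionHard` (stmt-ValiantsHypothesis-5065), line `pair-descent-jss-endpoint` —
RUNG 6: the crux for cofactors whose VARIATION misses polylogarithmically many rows (or columns)

`PerDivisionHard` asks: for every `c`, for all large `n`, every nonzero `h ∈ ℝ≥0[x_ij]` has
`2^{(log₂ n + c)^c} < L(per_n · h) + L(h)`.  This file proves it UNCONDITIONALLY for every cofactor
`h` all of whose monomials AGREE on the cells of a set `J` of at least `(log₂ n + d)^d` rows
(`perDivisionHard_rowsConstant`; column form `perDivisionHard_colsConstant`; `d = d(c)`), in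
particular for every `h` using no variable in such a set of rows or columns
(`perDivisionHard_rowsAvoided`, `perDivisionHard_colsAvoided`) and for every `x^u · h₀` with `h₀`
in the variables of the other rows — whatever `h` does elsewhere (dense supports, sums of products
in different frames, any number of monomials).  So the open core of the line (`stub_edgeEntropy`)
concerns only cofactors whose difference support meets all but polylogarithmically many rows AND
all but polylogarithmically many columns (cf. refuter memo B1: density → 1).

Mechanism.  Place the block rows of `G(b,1) ⊕ M₀` (`b = (log₂ n + d₀)^{d₀}`) INSIDE `J`.  After the
torus normal form (`stub_torusSupport`, a sub-support, so still constant on `J`) the generic cut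
(`stub_genericCut`) has a top fibre agreeing off the placed face `G`; on the block cells (rows in
`J`) all monomials agree, and on the single `G`-cell of a padding row two fibre monomials agree
because they have equal row margins and agree on the rest of the row
(`eq_pad_of_mem_placedBlock_row_aux`).  Hence the fibre is ONE monomial, and face descent
(`stub_faceDescent`), JSS contraction (`stub_jssContraction`) and the hardness of the placed face
(`stub_blockArsenal`) finish exactly as in the skeleton's composition.
-/

noncomputable section

-- `Summit.ValiantsHypothesis.ValiantsHypothesis.…` is the tree's mandated single-conjunct layout
-- (Sub = Summit), so the duplicated namespace component is intended.
set_option linter.dupNamespace false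

namespace Summit.ValiantsHypothesis.ValiantsHypothesis.Theorems.DivisionGapPerDivisionHard

open MvPolynomial Literature.Computability.AlgebraicComplexity
open Summit.ValiantsHypothesis.ValiantsHypothesis.Theorems.ZeroOneTransfer.Negative
  (topComponent support_topComponent_subset topComponent_ne_zero)
open scoped NNReal

/-- Neighbours of a padding column: its own padding row only (local copy; the module
`…CutsOutDiag.lean` carrying `adj_paddingCol` is not yet built on the farm snapshot). [folklore] -/
private theorem adj_paddingCol_aux {b k m : ℕ} {u : Fin m} {r : BlockV b k m}
    (hr : blockAdj b k m r (Sum.inr (Sum.inr u)) = true) : r = Sum.inr (Sum.inr u) := by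
  rcases r with i | ⟨i, j, t⟩ | u'
  · simp [blockAdj] at hr
  · simp [blockAdj] at hr
  · simp only [blockAdj, decide_eq_true_eq] at hr
    rw [hr]

/-- In a placed block graph, a cell of `G` in a padding row is the padding cell of that row
(local copy of `eq_pad_of_mem_placedBlock_row`). [folklore] -/
private theorem eq_pad_of_mem_placedBlock_row_aux {b k m n : ℕ} (eR eC : BlockV b k m ≃ Fin n)
    {c : Fin n} {u : Fin m} (h : (eR (Sum.inr (Sum.inr u)), c) ∈ placedBlock eR eC) :
    c = eC (Sum.inr (Sum.inr u)) := by
  simp only [placedBlock, Finset.mem_filter, Finset.mem_univ, true_and, Equiv.symm_apply_apply] at h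
  have := adj_paddingRow h
  rw [← this, Equiv.apply_symm_apply]

/-- In a placed block graph, a cell of `G` in a padding column is the padding cell of that column
(local copy of `eq_pad_of_mem_placedBlock_col`). [folklore] -/
private theorem eq_pad_of_mem_placedBlock_col_aux {b k m n : ℕ} (eR eC : BlockV b k m ≃ Fin n)
    {r : Fin n} {u : Fin m} (h : (r, eC (Sum.inr (Sum.inr u))) ∈ placedBlock eR eC) :
    r = eR (Sum.inr (Sum.inr u)) := by
  simp only [placedBlock, Finset.mem_filter, Finset.mem_univ, true_and, Equiv.symm_apply_apply] at h
  have := adj_paddingCol_aux h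
  rw [← this, Equiv.apply_symm_apply]

/-- Polylog bookkeeping: `b + b·(b·1) ≤ (log₂ n + (2d₀+2))^{2d₀+2}` for `b = (log₂ n + d₀)^{d₀}`.
[folklore] -/
theorem block_le_logPow (L d₀ : ℕ) :
    (L + d₀) ^ d₀ + (L + d₀) ^ d₀ * ((L + d₀) ^ d₀ * 1) ≤ (L + (2 * d₀ + 2)) ^ (2 * d₀ + 2) := by
  set b := (L + d₀) ^ d₀ with hb
  set x := L + (2 * d₀ + 2) with hx
  have h1 : b ≤ x ^ d₀ := Nat.pow_le_pow_left (by omega) d₀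
  have h2 : 2 ≤ x := by omega
  have hbb : b ≤ b * b := Nat.le_mul_self b
  have e2 : b * b ≤ x ^ d₀ * x ^ d₀ := Nat.mul_le_mul h1 h1
  calc b + b * (b * 1) ≤ 2 * (b * b) := by rw [mul_one]; omega
    _ ≤ 2 * (x ^ d₀ * x ^ d₀) := Nat.mul_le_mul_left 2 e2
    _ ≤ x * (x ^ d₀ * x ^ d₀) := Nat.mul_le_mul_right _ h2
    _ ≤ x * x * (x ^ d₀ * x ^ d₀) := Nat.mul_le_mul_right _ (Nat.le_mul_self x)
    _ = x ^ (2 * d₀ + 2) := by ring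

/-- **Rung 6 of the crux (cofactors whose variation misses polylog rows): `PerDivisionHard`'s
inequality for every nonzero `h` all of whose monomials AGREE on the cells of a set `J` of at least
`(log₂ n + d)^d` rows** (`d = d(c)`, `n ≥ n₀(c)`) — e.g. `h = x^u · h₀` with `h₀` in the variables
of the other rows, whatever `h₀` is. -/
theorem perDivisionHard_rowsConstant :
    ∀ c : ℕ, ∃ d n₀ : ℕ, ∀ n ≥ n₀, ∀ h : MvPolynomial (Fin n × Fin n) ℝ≥0, h ≠ 0 →
      ∀ J : Finset (Fin n), (Nat.log 2 n + d) ^ d ≤ J.card →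
      (∀ m₁ ∈ h.support, ∀ m₂ ∈ h.support, ∀ e : Fin n × Fin n, e.1 ∈ J → m₁ e = m₂ e) →
      2 ^ ((Nat.log 2 n + c) ^ c) < complexity (perPoly (Fin n) ℝ≥0 * h) + complexity h := by
  classical
  intro c
  obtain ⟨κ, hcon⟩ := stub_jssContraction
  obtain ⟨d₀, n₁, hhard⟩ := stub_blockArsenal c κ
  refine ⟨2 * d₀ + 2, n₁, fun n hn h hh J hJ hconst => ?_⟩
  -- block parameters: `b = (log₂ n + d₀)^{d₀}`, `k = 1`, `N = b + b²` block rows inside `J`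
  set b := (Nat.log 2 n + d₀) ^ d₀ with hb
  set N := b + b * (b * 1) with hN
  have hNJ : N ≤ J.card := le_trans (block_le_logPow (Nat.log 2 n) d₀) hJ
  obtain ⟨R, hRJ, hRcard⟩ := Finset.exists_subset_card_eq hNJ
  obtain ⟨eR, heR₁, heR₂⟩ := exists_blockEquiv R b 1 (n - N) hRcard (by rw [hRcard])
  set G := placedBlock eR eR with hG
  -- torus normal form, still constant on the rows of `J` (a sub-support)
  obtain ⟨h', hh', htor, hsupp, hle1, hle2⟩ := stub_torusSupport n h hh
  have hconst' : ∀ m₁ ∈ h'.support, ∀ m₂ ∈ h'.support, ∀ e : Fin n × Fin n, e.1 ∈ J →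
      m₁ e = m₂ e := fun m₁ hm₁ m₂ hm₂ e he => hconst m₁ (hsupp hm₁) m₂ (hsupp hm₂) e he
  have hdeg : ∀ p₁ ∈ h'.support, ∀ p₂ ∈ h'.support, p₁.degree = p₂.degree := by
    intro p₁ hp₁ p₂ hp₂
    obtain ⟨r₀, c₀, hrc⟩ := htor
    exact degree_eq_of_rowDegrees_eq ((hrc p₁ hp₁).1.trans (hrc p₂ hp₂).1.symm)
  -- the generic cut
  obtain ⟨w, hcut, hagree⟩ := stub_genericCut b 1 (n - N) n eR eR h' Nat.one_pos hdeg
  -- its top fibre is a single monomial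
  have hfib : ∀ m₁ ∈ (topComponent w h').support, ∀ m₂ ∈ (topComponent w h').support, m₁ = m₂ := by
    intro m₁ hm₁ m₂ hm₂
    have hs₁ := support_topComponent_subset _ h' hm₁
    have hs₂ := support_topComponent_subset _ h' hm₂
    have hoff := hagree m₁ hm₁ m₂ hm₂
    -- equal row margins
    obtain ⟨r₀, c₀, hrc⟩ := htor
    have hrows : rowDegrees m₁ = rowDegrees m₂ := (hrc m₁ hs₁).1.trans (hrc m₂ hs₂).1.symm
    ext e
    by_cases heG : e ∈ G
    swap
    · exact hoff e heG
    -- `e ∈ G`: either a block cell (row in `R ⊆ J`, where `h'` is constant) or a padding cell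
    obtain ⟨x, hx⟩ := eR.surjective e.1
    rcases x with i | p | u
    · exact hconst' m₁ hs₁ m₂ hs₂ e (hRJ (hx ▸ heR₁ i))
    · exact hconst' m₁ hs₁ m₂ hs₂ e (hRJ (hx ▸ heR₂ p))
    · -- padding row `r = e.1`: its only `G`-cell is the padding cell, and row sums agree
      set r := e.1 with hr
      have hpadcol : ∀ c', (r, c') ∈ G → c' = eR (Sum.inr (Sum.inr u)) := by
        intro c' hc'
        rw [← hx] at hc'
        exact eq_pad_of_mem_placedBlock_row_aux eR eR hc'
      have he2 : e.2 = eR (Sum.inr (Sum.inr u)) := hpadcol e.2 (by rw [hr]; exact heG)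
      -- all other cells of the row are off `G`, hence agree
      have hother : ∀ c', c' ≠ e.2 → m₁ (r, c') = m₂ (r, c') := by
        intro c' hc'
        refine hoff (r, c') fun hmem => hc' ?_
        rw [hpadcol c' hmem, he2]
      have hsum : ∑ c', m₁ (r, c') = ∑ c', m₂ (r, c') := by
        rw [← rowDegrees_apply, ← rowDegrees_apply, hrows]
      rw [← Finset.add_sum_erase _ _ (Finset.mem_univ e.2),
        ← Finset.add_sum_erase _ _ (Finset.mem_univ e.2)] at hsum
      have hrest : ∑ c' ∈ Finset.univ.erase e.2, m₁ (r, c') = ∑ c' ∈ Finset.univ.erase e.2, m₂ (r, c') :=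
        Finset.sum_congr rfl fun c' hc' => hother c' (Finset.ne_of_mem_erase hc')
      rw [hrest] at hsum
      have : m₁ (r, e.2) = m₂ (r, e.2) := by omega
      simpa [hr] using this
  obtain ⟨m₀, hm₀⟩ := support_nonempty.mpr (topComponent_ne_zero w hh')
  have hsingle : HasSingleGPart G w h' (m₀.filter (· ∈ G)) := by
    refine ⟨fun e he => ?_, fun m' hm' e he => ?_⟩
    · rw [Finsupp.support_filter] at he
      exact (Finset.mem_filter.mp he).2
    · rw [hfib m' hm' m₀ hm₀, Finsupp.filter_apply_pos _ _ he]
  -- face descent, JSS contraction, hardness of the placed face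
  by_contra hlt
  have hle : complexity (perPoly (Fin n) ℝ≥0 * h) + complexity h ≤
      2 ^ ((Nat.log 2 n + c) ^ c) := not_lt.mp hlt
  have hdesc := stub_faceDescent n G w h' (m₀.filter (· ∈ G)) hcut hh' hsingle
  have h1 : complexity (monomial (m₀.filter (· ∈ G)) (1 : ℝ≥0) * facePer G) ≤
      2 ^ ((Nat.log 2 n + c) ^ c) + 1 :=
    calc complexity (monomial (m₀.filter (· ∈ G)) (1 : ℝ≥0) * facePer G)
        ≤ complexity (perPoly (Fin n) ℝ≥0 * h') + 1 := hdesc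
      _ ≤ complexity (perPoly (Fin n) ℝ≥0 * h) + 1 := Nat.add_le_add_right hle1 1
      _ ≤ 2 ^ ((Nat.log 2 n + c) ^ c) + 1 :=
          Nat.add_le_add_right (le_trans (Nat.le_add_right _ _) hle) 1
  have h2 : complexity (facePer G) ≤ ((n + 2) * (2 ^ ((Nat.log 2 n + c) ^ c) + 3)) ^ κ :=
    calc complexity (facePer G)
        ≤ ((n + 2) * (complexity (monomial (m₀.filter (· ∈ G)) (1 : ℝ≥0) * facePer G) + 2)) ^ κ :=
          hcon n (facePer G) (m₀.filter (· ∈ G))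
      _ ≤ ((n + 2) * (2 ^ ((Nat.log 2 n + c) ^ c) + 3)) ^ κ :=
          Nat.pow_le_pow_left (Nat.mul_le_mul_left _ (by omega)) κ
  have h3 := hhard n hn b 1 (n - N) eR eR (le_of_eq hb.symm)
  exact absurd (lt_of_lt_of_le h3 h2) (lt_irrefl _)

/-- **Rung 6, column form: `PerDivisionHard`'s inequality for every nonzero `h` all of whose
monomials agree on the cells of a set `K` of at least `(log₂ n + d)^d` columns** (`d = d(c)`,
`n ≥ n₀(c)`) — the same proof with block columns inside `K` and column margins on the padding
columns. -/
theorem perDivisionHard_colsConstant :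
    ∀ c : ℕ, ∃ d n₀ : ℕ, ∀ n ≥ n₀, ∀ h : MvPolynomial (Fin n × Fin n) ℝ≥0, h ≠ 0 →
      ∀ K : Finset (Fin n), (Nat.log 2 n + d) ^ d ≤ K.card →
      (∀ m₁ ∈ h.support, ∀ m₂ ∈ h.support, ∀ e : Fin n × Fin n, e.2 ∈ K → m₁ e = m₂ e) →
      2 ^ ((Nat.log 2 n + c) ^ c) < complexity (perPoly (Fin n) ℝ≥0 * h) + complexity h := by
  classical
  intro c
  obtain ⟨κ, hcon⟩ := stub_jssContraction
  obtain ⟨d₀, n₁, hhard⟩ := stub_blockArsenal c κ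
  refine ⟨2 * d₀ + 2, n₁, fun n hn h hh K hK hconst => ?_⟩
  -- block parameters: `b = (log₂ n + d₀)^{d₀}`, `k = 1`, `N = b + b²` block columns inside `K`
  set b := (Nat.log 2 n + d₀) ^ d₀ with hb
  set N := b + b * (b * 1) with hN
  have hNK : N ≤ K.card := le_trans (block_le_logPow (Nat.log 2 n) d₀) hK
  obtain ⟨R, hRK, hRcard⟩ := Finset.exists_subset_card_eq hNK
  obtain ⟨eR, heR₁, heR₂⟩ := exists_blockEquiv R b 1 (n - N) hRcard (by rw [hRcard])
  set G := placedBlock eR eR with hG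
  -- torus normal form, still constant on the columns of `K` (a sub-support)
  obtain ⟨h', hh', htor, hsupp, hle1, hle2⟩ := stub_torusSupport n h hh
  have hconst' : ∀ m₁ ∈ h'.support, ∀ m₂ ∈ h'.support, ∀ e : Fin n × Fin n, e.2 ∈ K →
      m₁ e = m₂ e := fun m₁ hm₁ m₂ hm₂ e he => hconst m₁ (hsupp hm₁) m₂ (hsupp hm₂) e he
  have hdeg : ∀ p₁ ∈ h'.support, ∀ p₂ ∈ h'.support, p₁.degree = p₂.degree := by
    intro p₁ hp₁ p₂ hp₂
    obtain ⟨r₀, c₀, hrc⟩ := htor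
    exact degree_eq_of_rowDegrees_eq ((hrc p₁ hp₁).1.trans (hrc p₂ hp₂).1.symm)
  -- the generic cut
  obtain ⟨w, hcut, hagree⟩ := stub_genericCut b 1 (n - N) n eR eR h' Nat.one_pos hdeg
  -- its top fibre is a single monomial
  have hfib : ∀ m₁ ∈ (topComponent w h').support, ∀ m₂ ∈ (topComponent w h').support, m₁ = m₂ := by
    intro m₁ hm₁ m₂ hm₂
    have hs₁ := support_topComponent_subset _ h' hm₁
    have hs₂ := support_topComponent_subset _ h' hm₂
    have hoff := hagree m₁ hm₁ m₂ hm₂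
    -- equal column margins
    obtain ⟨r₀, c₀, hrc⟩ := htor
    have hcols : Finsupp.mapDomain Prod.snd m₁ = Finsupp.mapDomain Prod.snd m₂ :=
      (hrc m₁ hs₁).2.trans (hrc m₂ hs₂).2.symm
    ext e
    by_cases heG : e ∈ G
    swap
    · exact hoff e heG
    -- `e ∈ G`: either a block cell (column in `R ⊆ K`, where `h'` is constant) or a padding cell
    obtain ⟨x, hx⟩ := eR.surjective e.2
    rcases x with i | p | u
    · exact hconst' m₁ hs₁ m₂ hs₂ e (hRK (hx ▸ heR₁ i))
    · exact hconst' m₁ hs₁ m₂ hs₂ e (hRK (hx ▸ heR₂ p))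
    · -- padding column `c' = e.2`: its only `G`-cell is the padding cell, and column sums agree
      set c' := e.2 with hc'
      have hpadrow : ∀ r, (r, c') ∈ G → r = eR (Sum.inr (Sum.inr u)) := by
        intro r hr
        rw [← hx] at hr
        exact eq_pad_of_mem_placedBlock_col_aux eR eR hr
      have he1 : e.1 = eR (Sum.inr (Sum.inr u)) := hpadrow e.1 (by rw [hc']; exact heG)
      -- all other cells of the column are off `G`, hence agree
      have hother : ∀ r, r ≠ e.1 → m₁ (r, c') = m₂ (r, c') := by
        intro r hr
        refine hoff (r, c') fun hmem => hr ?_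
        rw [hpadrow r hmem, he1]
      have hsum : ∑ r, m₁ (r, c') = ∑ r, m₂ (r, c') := by
        rw [← colDegrees_apply, ← colDegrees_apply, hcols]
      rw [← Finset.add_sum_erase _ _ (Finset.mem_univ e.1),
        ← Finset.add_sum_erase _ _ (Finset.mem_univ e.1)] at hsum
      have hrest : ∑ r ∈ Finset.univ.erase e.1, m₁ (r, c') = ∑ r ∈ Finset.univ.erase e.1, m₂ (r, c') :=
        Finset.sum_congr rfl fun r hr => hother r (Finset.ne_of_mem_erase hr)
      rw [hrest] at hsum
      have : m₁ (e.1, c') = m₂ (e.1, c') := by omega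
      simpa [hc'] using this
  obtain ⟨m₀, hm₀⟩ := support_nonempty.mpr (topComponent_ne_zero w hh')
  have hsingle : HasSingleGPart G w h' (m₀.filter (· ∈ G)) := by
    refine ⟨fun e he => ?_, fun m' hm' e he => ?_⟩
    · rw [Finsupp.support_filter] at he
      exact (Finset.mem_filter.mp he).2
    · rw [hfib m' hm' m₀ hm₀, Finsupp.filter_apply_pos _ _ he]
  -- face descent, JSS contraction, hardness of the placed face
  by_contra hlt
  have hle : complexity (perPoly (Fin n) ℝ≥0 * h) + complexity h ≤
      2 ^ ((Nat.log 2 n + c) ^ c) := not_lt.mp hlt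
  have hdesc := stub_faceDescent n G w h' (m₀.filter (· ∈ G)) hcut hh' hsingle
  have h1 : complexity (monomial (m₀.filter (· ∈ G)) (1 : ℝ≥0) * facePer G) ≤
      2 ^ ((Nat.log 2 n + c) ^ c) + 1 :=
    calc complexity (monomial (m₀.filter (· ∈ G)) (1 : ℝ≥0) * facePer G)
        ≤ complexity (perPoly (Fin n) ℝ≥0 * h') + 1 := hdesc
      _ ≤ complexity (perPoly (Fin n) ℝ≥0 * h) + 1 := Nat.add_le_add_right hle1 1
      _ ≤ 2 ^ ((Nat.log 2 n + c) ^ c) + 1 :=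
          Nat.add_le_add_right (le_trans (Nat.le_add_right _ _) hle) 1
  have h2 : complexity (facePer G) ≤ ((n + 2) * (2 ^ ((Nat.log 2 n + c) ^ c) + 3)) ^ κ :=
    calc complexity (facePer G)
        ≤ ((n + 2) * (complexity (monomial (m₀.filter (· ∈ G)) (1 : ℝ≥0) * facePer G) + 2)) ^ κ :=
          hcon n (facePer G) (m₀.filter (· ∈ G))
      _ ≤ ((n + 2) * (2 ^ ((Nat.log 2 n + c) ^ c) + 3)) ^ κ :=
          Nat.pow_le_pow_left (Nat.mul_le_mul_left _ (by omega)) κ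
  have h3 := hhard n hn b 1 (n - N) eR eR (le_of_eq hb.symm)
  exact absurd (lt_of_lt_of_le h3 h2) (lt_irrefl _)

/-- **Corollary (cofactors avoiding polylog rows): `PerDivisionHard`'s inequality for every nonzero
`h` whose monomials use no variable in a set `J` of at least `(log₂ n + d)^d` rows.** -/
theorem perDivisionHard_rowsAvoided :
    ∀ c : ℕ, ∃ d n₀ : ℕ, ∀ n ≥ n₀, ∀ h : MvPolynomial (Fin n × Fin n) ℝ≥0, h ≠ 0 →
      ∀ J : Finset (Fin n), (Nat.log 2 n + d) ^ d ≤ J.card →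
      (∀ m ∈ h.support, ∀ e ∈ m.support, e.1 ∉ J) →
      2 ^ ((Nat.log 2 n + c) ^ c) < complexity (perPoly (Fin n) ℝ≥0 * h) + complexity h := by
  intro c
  obtain ⟨d, n₀, H⟩ := perDivisionHard_rowsConstant c
  refine ⟨d, n₀, fun n hn h hh J hJ havoid => H n hn h hh J hJ fun m₁ hm₁ m₂ hm₂ e he => ?_⟩
  have h1 : m₁ e = 0 := by
    by_contra hne
    exact havoid m₁ hm₁ e (Finsupp.mem_support_iff.mpr hne) he
  have h2 : m₂ e = 0 := by
    by_contra hne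
    exact havoid m₂ hm₂ e (Finsupp.mem_support_iff.mpr hne) he
  rw [h1, h2]

/-- **Corollary (cofactors avoiding polylog columns).** -/
theorem perDivisionHard_colsAvoided :
    ∀ c : ℕ, ∃ d n₀ : ℕ, ∀ n ≥ n₀, ∀ h : MvPolynomial (Fin n × Fin n) ℝ≥0, h ≠ 0 →
      ∀ K : Finset (Fin n), (Nat.log 2 n + d) ^ d ≤ K.card →
      (∀ m ∈ h.support, ∀ e ∈ m.support, e.2 ∉ K) →
      2 ^ ((Nat.log 2 n + c) ^ c) < complexity (perPoly (Fin n) ℝ≥0 * h) + complexity h := by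
  intro c
  obtain ⟨d, n₀, H⟩ := perDivisionHard_colsConstant c
  refine ⟨d, n₀, fun n hn h hh K hK havoid => H n hn h hh K hK fun m₁ hm₁ m₂ hm₂ e he => ?_⟩
  have h1 : m₁ e = 0 := by
    by_contra hne
    exact havoid m₁ hm₁ e (Finsupp.mem_support_iff.mpr hne) he
  have h2 : m₂ e = 0 := by
    by_contra hne
    exact havoid m₂ hm₂ e (Finsupp.mem_support_iff.mpr hne) he
  rw [h1, h2]

end Summit.ValiantsHypothesis.ValiantsHypothesis.Theorems.DivisionGapPerDivisionHard

end
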